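import Summits.QuantumFields.YangMills.Theorems.BalabanUVNodesN27AtRecord12
import Summits.QuantumFields.YangMills.Theorems.BalabanUVNodesSpineCarriersOfRecord12
import Summits.QuantumFields.YangMills.Theorems.BalabanUVNodesRateCarriersOfRecord12

/-!
# BalabanUVNodes ∕ N27 = binder B5 AT THE RECORD, XXVII — N27 AT THE STAGE-12 CARRIER HOMES OF RECORD: B5 `Spine ₁₂C` from the one-application stub instances at
# (T-SPINE)₁₂ `YMDAG.UVSplit.SRec₁₂ cr` (dag-n20-d, `…SpineCarriersOfRecord12`) and (T-RATE)₁₂ `YMDAG.UVSplit.RRec₁₂ 𝔯` (dag-n22-e, `…RateCarriersOfRecord12`, keyed by RR-2's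
# canonical datum key `Node00.IsDatumOfRecord₁₂C` ∕ `.params`) and the N19′ edge AT THE HOMES' OWN KEYS — the K4 existence stub `S_R00x` DISCHARGED BY NAME
# (`s_R00x_rRec₁₂`): the divided-home knit g0's HANDOFF (t1) asked for, at the repaired record
# (cell `pub-ymgap`, HUMAN RULING D-0062 Track A, R134 seat `pub-ymgap-dag-n27-c` (s2) gen 2; `--supports` the K3′ item `SpineGivenEndpointR12` stmt-QuantumFields-19792 (dag-lead
# WORDS-108 key table); COUNT-NEUTRAL; `N`-generic, NO Theses import — the route-facing `N = 2` line is module XXVI's `spineGivenEndpointR12_of_homes₁₂`)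

THE KNIT.  XIV `spine_of_rateStubs_coreEdge` at `Rec := Node00.IsRecordOfRecord₁₂C F N`, `SRec := SRec₁₂ cr`, `RRec := RRec₁₂ 𝔯`:
* `S_R00x ₁₂C (RRec₁₂ 𝔯)` — PROVED at the home (`YMDAG.UVSplit.s_R00x_rRec₁₂`: the run-length-0 bundle at the record's own datum key; existence of residual objects is free),
  so it is NOT a hypothesis here;
* `S_N14`–`S_N18`, `S_N22` at `RRec₁₂ 𝔯` — the home's one-application instances (`s_N14_rRec₁₂_iff` … `s_N22_rRec₁₂_iff`: each IS the node's estimate at the reading `𝔯` read at every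
  Stage-12 datum key), HYPOTHESES;
* `S_N27x ₁₂C (SRec₁₂ cr)`, `S_N20`, `S_N21` at `SRec₁₂ cr` — the home's instances (`s_N27x_sRec₁₂_of`, `s_N20_sRec₁₂_iff`, `s_N21_sRec₁₂_iff`), HYPOTHESES;
* the N19′ ∃δ-edge AT THE TWO HOMES' KEYS (`h19`): for every admissible Stage-12 `θ` with provisos, every `g₀`, `os`, every datum key `h : IsDatumOfRecord₁₂C F N (datumOfRecord₁₂ F N θ hP)`
  of θ's own datum and every run length `k`: the six rates at the CANONICAL rate bundle `rateCarriersOfRecord₁₂ 𝔯 F h.params h.provisos g₀ os k` give SOME summable `δ` carrying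
  `Spine.NE7.Core` on the shell-free cores of `cr F θ hP g₀ os` — the pair form of XXII∕XXIV (`θ` vs the canonical `h.params` of the same datum) specialised to the homes
  (`coreEdge_of_homes₁₂`).

WHAT IS KERNEL-CHECKED ([bookkeeping]; 0 `def`, 0 `sorry`): `coreEdge_of_homes₁₂` · **`spine_rec12C_of_homes₁₂`** (the knit above ⇒ `Spine ₁₂C`) · `spine_rec12C_of_homes₁₂_faces` (the same with
the spine-side stubs replaced by their θ-indexed readings through the home's faces: N20 `RelWeightBound` ∕ N21 `ShellWeightBound` at `cr F θ hP g₀ os`, N27x's unconditional θ-form) ·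
`keyedUnity₁₂_of_homes₁₂` (the θ-keyed K3′ conclusion on any guarded class, a fortiori — XXV `spine_rec12C_iff_forall_datumOfRecord₁₂`).

HONEST FRAMING.  COMPOSITE-node bookkeeping: every K4∕K5 stub and the edge are HYPOTHESES with NO producer at any record today (0∕1); the readings `cr`, `𝔯` are PARAMETERS of the homes
(no reading of Bałaban's dressed expansion ∕ dressed tower of record exists — dag-n20-e LOCATED (F1)–(F4), RR-1's residual `𝔱`; ref-D WATCH-N27-KEYED-INSTANCE stands at the homes);
`S_R00x` is discharged only because residual objects exist by construction (located, not content); nothing of Bałaban's asserted; NE7 ∕ NE7b ∕ NE7c NOT PRINTED for d = 4 and NOT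
PROVED; NO node discharged; K3′ NOT claimed; counts UNMOVED (typed 28∕28 · discharged 5∕27, A 5∕28); one finite four-torus programme at fixed `ε` — NOT ℝ⁴, NOT infinite volume, NOT OS,
NOT a mass gap, NOT Clay.  No decl below carries a cite tag.
-/

namespace Summit.QuantumFields.YangMills.Theorems.BalabanUVNodesN27SpineRecord

open Literature.MathematicalPhysics.QuantumFieldTheory.Balaban1983to89
open Literature.MathematicalPhysics.QuantumFieldTheory.Balaban1983to89.T4Continuum
open T4WeightBudget (RelWeightBound)
open T4IndicatorShell (ShellWeightBound)
open T4ContinuumYM4Torus (ForSmallCouplings)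
open Summit.QuantumFields.BalabanUV.T4Continuum.Spine
open YMDAG.UVSplit
open Node00 (Stage12Params datumOfRecord₁₂ IsRecordOfRecord₁₂C IsDatumOfRecord₁₂C)

variable {N : ℕ} [NeZero N] (cr : SpineReading₁₂ N) (𝔯 : RateReading₁₂ N)

/-! ## §1 The N19′ edge at the two homes' keys -/

/-- **XIV's N19′ EDGE AT `(SRec₁₂ cr, RRec₁₂ 𝔯)`**: a bundle pinned by `SRec₁₂ cr` is `cr F θ hP g₀ os` for an admissible θ with provisos realising `D`; rate carriers pinned by `RRec₁₂ 𝔯` at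
the same `D` are a run length `k` of the canonical bundle at a datum key of `D`; so the edge XIV consumes is the HOME-KEYED pair form `h19`. [bookkeeping] -/
theorem coreEdge_of_homes₁₂
    (h19 : ∀ (F : T4Family) (θ : Stage12Params F N) (hP : θ.Provisos₁₂ F N), θ.Admissible F N → ∀ (g₀ : ℕ → ℝ) (os : List (ULoop F))
      (h : IsDatumOfRecord₁₂C F N (datumOfRecord₁₂ F N θ hP)) (k : ℕ),
      RatesAt (datumOfRecord₁₂ F N θ hP) (rateCarriersOfRecord₁₂ 𝔯 F h.params h.provisos g₀ os k) → letI := (cr F θ hP g₀ os).dec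
        ∃ δ : ℕ → ℝ, NE7.Core (cr F θ hP g₀ os).l₀ (cr F θ hP g₀ os).vol (cr F θ hP g₀ os).T (cr F θ hP g₀ os).Bad
          (fun K t τ => (cr F θ hP g₀ os).A K t τ - (cr F θ hP g₀ os).shA K t τ) (fun K t τ => (cr F θ hP g₀ os).B K t τ - (cr F θ hP g₀ os).shB K t τ) δ ∧
          Summable δ)
    (F : T4Family) (D : Datum F N) (g₀ : ℕ → ℝ) (os : List (ULoop F)) (S : SpineCarriers) (R : RateCarriers N)
    (hS : SRec₁₂ cr F D g₀ os S) (hR : RRec₁₂ 𝔯 F D g₀ os R) (hrates : RatesAt D R) : letI := S.dec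
      ∃ δ : ℕ → ℝ, NE7.Core S.l₀ S.vol S.T S.Bad (fun K t τ => S.A K t τ - S.shA K t τ) (fun K t τ => S.B K t τ - S.shB K t τ) δ ∧ Summable δ := by
  obtain ⟨θ, hP, hθ, rfl, rfl⟩ := hS
  obtain ⟨h, k, rfl⟩ := hR
  exact h19 F θ hP hθ g₀ os h k hrates

/-! ## §2 The knit at the homes -/

/-- **N27 = B5 AT THE STAGE-12 RECORD FROM THE STUB INSTANCES OF THE TWO CARRIER HOMES OF RECORD AND THE HOME-KEYED N19′ EDGE — `S_R00x` DISCHARGED BY NAME.**  XIV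
`spine_of_rateStubs_coreEdge` at `(₁₂C, SRec₁₂ cr, RRec₁₂ 𝔯)` with `hx := s_R00x_rRec₁₂ 𝔯` (home theorem): the six K4 stubs at `RRec₁₂ 𝔯`, the three K5 stubs at `SRec₁₂ cr` and `h19` give
`Spine ₁₂C`.  Every remaining stub a HYPOTHESIS (0∕1 today). [bookkeeping] -/
theorem spine_rec12C_of_homes₁₂ (h14 : S_N14 (RRec₁₂ 𝔯)) (h15 : S_N15 (RRec₁₂ 𝔯)) (h16 : S_N16 (RRec₁₂ 𝔯)) (h17 : S_N17 (RRec₁₂ 𝔯))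
    (h18 : S_N18 (RRec₁₂ 𝔯)) (h22 : S_N22 (RRec₁₂ 𝔯)) (hx' : S_N27x (fun F D w => IsRecordOfRecord₁₂C F N D w) (SRec₁₂ cr)) (h20 : S_N20 (SRec₁₂ cr))
    (h21 : S_N21 (SRec₁₂ cr))
    (h19 : ∀ (F : T4Family) (θ : Stage12Params F N) (hP : θ.Provisos₁₂ F N), θ.Admissible F N → ∀ (g₀ : ℕ → ℝ) (os : List (ULoop F))
      (h : IsDatumOfRecord₁₂C F N (datumOfRecord₁₂ F N θ hP)) (k : ℕ),
      RatesAt (datumOfRecord₁₂ F N θ hP) (rateCarriersOfRecord₁₂ 𝔯 F h.params h.provisos g₀ os k) → letI := (cr F θ hP g₀ os).dec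
        ∃ δ : ℕ → ℝ, NE7.Core (cr F θ hP g₀ os).l₀ (cr F θ hP g₀ os).vol (cr F θ hP g₀ os).T (cr F θ hP g₀ os).Bad
          (fun K t τ => (cr F θ hP g₀ os).A K t τ - (cr F θ hP g₀ os).shA K t τ) (fun K t τ => (cr F θ hP g₀ os).B K t τ - (cr F θ hP g₀ os).shB K t τ) δ ∧
          Summable δ) :
    Spine (N := N) fun F D w => IsRecordOfRecord₁₂C F N D w :=
  spine_of_rateStubs_coreEdge _ (SRec₁₂ cr) (RRec₁₂ 𝔯) (s_R00x_rRec₁₂ 𝔯) h14 h15 h16 h17 h18 h22 hx' h20 h21 (coreEdge_of_homes₁₂ cr 𝔯 h19)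

/-- **THE SAME WITH THE SPINE-SIDE STUBS READ THROUGH THE HOME's FACES**: N20 `RelWeightBound` and N21 `ShellWeightBound` at `cr F θ hP g₀ os` for every admissible Stage-12 θ with
provisos (`s_N20_sRec₁₂_iff` ∕ `s_N21_sRec₁₂_iff`), and N27x's unconditional θ-form (`s_N27x_sRec₁₂_of`: positivity + E1∕E2 against the datum's dressed partition functions at every
admissible θ); rate stubs as in `spine_rec12C_of_homes₁₂`. [bookkeeping] -/
theorem spine_rec12C_of_homes₁₂_faces (h14 : S_N14 (RRec₁₂ 𝔯)) (h15 : S_N15 (RRec₁₂ 𝔯)) (h16 : S_N16 (RRec₁₂ 𝔯)) (h17 : S_N17 (RRec₁₂ 𝔯))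
    (h18 : S_N18 (RRec₁₂ 𝔯)) (h22 : S_N22 (RRec₁₂ 𝔯))
    (hx : ∀ (F : T4Family) (θ : Stage12Params F N) (hP : θ.Provisos₁₂ F N), θ.Admissible F N → ∀ (g₀ : ℕ → ℝ) (os : List (ULoop F)),
      0 < (cr F θ hP g₀ os).l₀ ∧ 0 < (cr F θ hP g₀ os).vol ∧
        (∀ (K : ℕ) (t : ℝ), |t| ≤ (cr F θ hP g₀ os).l₀ →
          T4GenFunBounds.schemeZ ((datumOfRecord₁₂ F N θ hP).scheme g₀) os ((cr F θ hP g₀ os).K₀ + K) t =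
            ∑ τ ∈ (cr F θ hP g₀ os).T K, (cr F θ hP g₀ os).A K t τ) ∧
        (∀ (K : ℕ) (t : ℝ), |t| ≤ (cr F θ hP g₀ os).l₀ →
          T4GenFunBounds.schemeZ ((datumOfRecord₁₂ F N θ hP).scheme g₀) os ((cr F θ hP g₀ os).K₀ + K + 1) t =
            ∑ τ ∈ (cr F θ hP g₀ os).T K, (cr F θ hP g₀ os).B K t τ))
    (h20 : ∀ (F : T4Family) (θ : Stage12Params F N) (hP : θ.Provisos₁₂ F N), θ.Admissible F N → ∀ (g₀ : ℕ → ℝ) (os : List (ULoop F)),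
      RelWeightBound (cr F θ hP g₀ os).l₀ (cr F θ hP g₀ os).T (cr F θ hP g₀ os).A (cr F θ hP g₀ os).B (cr F θ hP g₀ os).Bad (cr F θ hP g₀ os).W)
    (h21 : ∀ (F : T4Family) (θ : Stage12Params F N) (hP : θ.Provisos₁₂ F N), θ.Admissible F N → ∀ (g₀ : ℕ → ℝ) (os : List (ULoop F)),
      ShellWeightBound (cr F θ hP g₀ os).l₀ (cr F θ hP g₀ os).T (cr F θ hP g₀ os).A (cr F θ hP g₀ os).B (cr F θ hP g₀ os).shA (cr F θ hP g₀ os).shB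
        (cr F θ hP g₀ os).Wsh)
    (h19 : ∀ (F : T4Family) (θ : Stage12Params F N) (hP : θ.Provisos₁₂ F N), θ.Admissible F N → ∀ (g₀ : ℕ → ℝ) (os : List (ULoop F))
      (h : IsDatumOfRecord₁₂C F N (datumOfRecord₁₂ F N θ hP)) (k : ℕ),
      RatesAt (datumOfRecord₁₂ F N θ hP) (rateCarriersOfRecord₁₂ 𝔯 F h.params h.provisos g₀ os k) → letI := (cr F θ hP g₀ os).dec
        ∃ δ : ℕ → ℝ, NE7.Core (cr F θ hP g₀ os).l₀ (cr F θ hP g₀ os).vol (cr F θ hP g₀ os).T (cr F θ hP g₀ os).Bad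
          (fun K t τ => (cr F θ hP g₀ os).A K t τ - (cr F θ hP g₀ os).shA K t τ) (fun K t τ => (cr F θ hP g₀ os).B K t τ - (cr F θ hP g₀ os).shB K t τ) δ ∧
          Summable δ) :
    Spine (N := N) fun F D w => IsRecordOfRecord₁₂C F N D w :=
  spine_rec12C_of_homes₁₂ cr 𝔯 h14 h15 h16 h17 h18 h22 (s_N27x_sRec₁₂_of cr hx) ((s_N20_sRec₁₂_iff cr).mpr h20) ((s_N21_sRec₁₂_iff cr).mpr h21) h19

/-! ## §3 The θ-keyed guarded conclusion (the shape of the rev-13∕15 item K3′) from the homes, a fortiori -/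

/-- **FROM THE HOMES TO THE θ-KEYED GUARDED SENTENCE**: the knit at the homes gives B5 at EVERY ₁₂C record, hence at every admissible Stage-12 datum of record under ANY further guard
`G θ` (XXV `spine_rec12C_iff_forall_datumOfRecord₁₂`; at `N = 2`, `G := ZtUnity ∧ SlotsNondegenerate`, this is K3′ up to its displayed antecedents — module XXVI). [bookkeeping] -/
theorem keyedGuarded₁₂_of_spine_rec12C (G : ∀ {F : T4Family}, Stage12Params F N → Prop) (h : Spine (N := N) fun F D w => IsRecordOfRecord₁₂C F N D w)
    (F : T4Family) (θ : Stage12Params F N) (hP : θ.Provisos₁₂ F N) (_hG : G θ) (hθ : θ.Admissible F N) :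
    T4ApexHybrid.HybridNE7Under (datumOfRecord₁₂ F N θ hP) (DagBinding.EndpointExistence (datumOfRecord₁₂ F N θ hP).C.toB12) :=
  spine_rec12C_iff_forall_datumOfRecord₁₂.mp h F θ hP hθ

end Summit.QuantumFields.YangMills.Theorems.BalabanUVNodesN27SpineRecord
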